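import Literature.Topology.FourManifolds.SimplifiedBrokenLefschetzSidesGenus
import Literature.Topology.FourManifolds.DehnSurgeryUnknotZeroProofs
import Literature.Topology.FourManifolds.Morse
import Literature.Topology.FourManifolds.SphereFourGenusOneSplitting
import Literature.Topology.FourManifolds.TorusDiffeoLoops
import Literature.Topology.FourManifolds.SmoothSchoenfliesFiveLeCap
import Literature.Topology.FourManifolds.SimplifiedBrokenLefschetzSphereSideTube
import HarnessLib
set_option linter.dupNamespace false
noncomputable section
open scoped Manifold ContDiff Topology RealInnerProductSpace
open Set Function Literature.Topology.FourManifolds Literature.AlgebraicTopology.SingularHomology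
namespace Summit.SmoothPoincare4.SmoothPoincare4.Cruxes.RungOne.Sketch
/-- notation -/
local notation "𝔼 " n:arg => EuclideanSpace ℝ (Fin n)
/-- notation -/
local notation "𝕊²" => (Metric.sphere (0 : EuclideanSpace ℝ (Fin 3)) (1 : ℝ))
attribute [local instance] Literature.Topology.FourManifolds.fact_finrank_euclideanSpace_succ
/-- Statement R (registered helper `helper_sliceGluing_bottRecognition`): fibred Morse–Bott
recognition of the polar tube. -/
def StatementR : Prop :=
  ∀ (X : Type) [TopologicalSpace X] [T2Space X] [SecondCountableTopology X] [CompactSpace X] [ChartedSpace (𝔼 4) X] [IsManifold (𝓡 4) ∞ X], IsOrientable (𝓡 4) X → ∀ (F : X → ℝ) (a' a b : ℝ) (ha : IsRegularLevel (𝓡 4) F a) (e : (Metric.sphere (0 : 𝔼 2) 1) → X) (α : X → 𝔼 2), a' < a → a < b → Manifold.IsSmoothEmbedding (𝓡 1) (𝓡 4) ∞ e → (∀ x, a ≤ F x → F x ≤ b) → (∀ x, a ≤ F x → (IsMCriticalPt (𝓡 4) F x ↔ x ∈ range e)) → (∀ u, F (e u) = b) → (∀ (u : Metric.sphere (0 :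 𝔼 2) 1) (w : 𝔼 4), mhessian (𝓡 4) F (e u) w w ≤ 0 ∧ (mhessian (𝓡 4) F (e u) w w = 0 → w ∈ range (mfderiv (𝓡 1) (𝓡 4) e u))) → ContMDiffOn (𝓡 4) 𝓘(ℝ, 𝔼 2) ∞ α {x | a' < F x} → (∀ x, a' < F x → ‖α x‖ = 1) → (∀ u : Metric.sphere (0 : 𝔼 2) 1, α (e u) = (u : 𝔼 2)) → (∀ x, a ≤ F x → x ∉ range e → ∀ (r : ℝ) (w : 𝔼 2), ⟪w, α x⟫ = 0 → ∃ y : 𝔼 4, mfderiv (𝓡 4) 𝓘(ℝ, ℝ) F x y = r ∧ mfderiv (𝓡 4) 𝓘(ℝ, 𝔼 2) α x y = w) → ∃ Φ : RegularSuperlevel ha ≃ₘ⟮𝓡∂ 4, 𝓡∂ 4⟯ SphereFourSplitting.PolarTube, (∀ k : RegularSuperlevel ha, F (RegularSublevel.incl ha.const_sub k) = a → SphereFourSplitting.tubeS (SphereFourSplitting.ιV (Φ k)) = 1 / 2) ∧ ∀ k : RegularSuperlevel ha, RegularSublevel.incl ha.const_sub k ∉ range e → ∃ r : ℝ, 0 <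 r ∧ SphereFourSplitting.ι (SphereFourSplitting.ιV (Φ k)) 3 = r * (α (RegularSublevel.incl ha.const_sub k)) 0 ∧ SphereFourSplitting.ι (SphereFourSplitting.ιV (Φ k)) 4 = r * (α (RegularSublevel.incl ha.const_sub k)) 1

/-- Statement F (to be registered as `helper_sliceGluing_bottFunction`): the Morse–Bott function
with maximum circle the round locus and the angular map, on the complement of the sphere tube. -/
def StatementF : Prop :=
  gramain_loopHomotopy_translationLoop_torus →
  ∀ (X : Type) [TopologicalSpace X] [T2Space X] [SecondCountableTopology X] [CompactSpace X]
    [ChartedSpace (𝔼 4) X] [IsManifold (𝓡 4) ∞ X] [SimplyConnectedSpace X]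
    (o : SmoothOrientation (𝓡 4) X) (f : X → 𝕊²),
    IsSimplifiedBrokenLefschetzFibration o f ∅ 0 →
    f '' ({p : X | ¬ Surjective (mfderiv (𝓡 4) (𝓡 2) f p)} \ (↑(∅ : Finset X) : Set X)) =
      sphereEquator 1 →
    ∀ (v : 𝕊²) (ιX : 𝕊² × 𝔼 2 → X), (v : 𝔼 3) 0 = 0 → (v : 𝔼 3) 1 = 0 →
    Manifold.IsSmoothEmbedding ((𝓡 2).prod (𝓡 2)) (𝓡 4) ∞ ιX →
    range ιX = f ⁻¹' {y : 𝕊² | ⟪(y : 𝔼 3), (v : 𝔼 3)⟫ < 0} →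
    (∀ p, f (ιX p) = (stereographic' 2 v).symm
      (OpenPartialHomeomorph.univBall (0 : 𝔼 2) 2 p.2)) →
    (∀ y : 𝕊², ⟪(y : 𝔼 3), ((-v : 𝕊²) : 𝔼 3)⟫ < 0 →
      (∀ q, f q = y → Surjective (mfderiv (𝓡 4) (𝓡 2) f q)) ∧
      Module.finrank ℤ (singularHomology ℤ ℤ ↥(f ⁻¹' {y}) 1) = 2) →
    ∃ (F : X → ℝ) (a' a b : ℝ) (_ : IsRegularLevel (𝓡 4) F a)
      (e : (Metric.sphere (0 : 𝔼 2) 1) → X) (α : X → 𝔼 2),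
      a' < a ∧ a < b ∧ Manifold.IsSmoothEmbedding (𝓡 1) (𝓡 4) ∞ e ∧
      (∀ x, a ≤ F x → F x ≤ b) ∧
      (∀ x, a ≤ F x → (IsMCriticalPt (𝓡 4) F x ↔ x ∈ range e)) ∧
      (∀ u, F (e u) = b) ∧
      (∀ (u : Metric.sphere (0 : 𝔼 2) 1) (w : 𝔼 4), mhessian (𝓡 4) F (e u) w w ≤ 0 ∧
        (mhessian (𝓡 4) F (e u) w w = 0 → w ∈ range (mfderiv (𝓡 1) (𝓡 4) e u))) ∧
      ContMDiffOn (𝓡 4) 𝓘(ℝ, 𝔼 2) ∞ α {x | a' < F x} ∧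
      (∀ x, a' < F x → ‖α x‖ = 1) ∧
      (∀ u : Metric.sphere (0 : 𝔼 2) 1, α (e u) = (u : 𝔼 2)) ∧
      (∀ x, a ≤ F x → x ∉ range e → ∀ (r : ℝ) (w : 𝔼 2), ⟪w, α x⟫ = 0 →
        ∃ y : 𝔼 4, mfderiv (𝓡 4) 𝓘(ℝ, ℝ) F x y = r ∧ mfderiv (𝓡 4) 𝓘(ℝ, 𝔼 2) α x y = w) ∧
      ((fun y => (-1 / 2 : ℝ) - (SphereHeight.height (v : 𝔼 3) ∘ f) y) ⁻¹' Set.Iic 0 =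
        (fun y => a - F y) ⁻¹' Set.Iic 0) ∧
      (∀ x, (SphereHeight.height (v : 𝔼 3) ∘ f) x = -1 / 2 → F x = a) ∧
      (∀ p : 𝕊² × 𝔼 2, (SphereHeight.height (v : 𝔼 3) ∘ f) (ιX p) = -1 / 2 →
        α (ιX p) = (√2 : ℝ) • p.2 ∧ ‖p.2‖ ^ 2 = 1 / 2)

/-- **Assembly check: the apex `stub_sliceGluing` follows from Statement F and Statement R**
(transport along `RegularSublevel.diffeomorphOfPreimageEq`; on the boundary `F = a`, so the
polar coordinates of the image have norm `1/√2` and direction `α = √2 · w`). -/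
theorem stub_sliceGluing_of_bott (hR : StatementR) (hFb : StatementF) :
    (∀ (X : Type) [TopologicalSpace X] [T2Space X] [SecondCountableTopology X] [CompactSpace X]
      [ChartedSpace (𝔼 4) X] [IsManifold (𝓡 4) ∞ X]
      (o : SmoothOrientation (𝓡 4) X) (f : X → 𝕊²),
      IsSimplifiedBrokenLefschetzFibration o f ∅ 0 →
      f '' ({p : X | ¬ Surjective (mfderiv (𝓡 4) (𝓡 2) f p)} \ (↑(∅ : Finset X) : Set X)) =
        sphereEquator 1 →
      ∀ q : X, ¬ Surjective (mfderiv (𝓡 4) (𝓡 2) f q) →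
        mfderiv (𝓡 4) 𝓘(ℝ, ℝ)
          ((fun y : 𝕊² => -(((f q : 𝕊²) : 𝔼 3) 1) * (y : 𝔼 3) 0 +
              (((f q : 𝕊²) : 𝔼 3) 0) * (y : 𝔼 3) 1) ∘ f) q ≠ 0) →
    gramain_loopHomotopy_translationLoop_torus →
    ∀ (X : Type) [TopologicalSpace X] [T2Space X] [SecondCountableTopology X] [CompactSpace X]
      [ChartedSpace (𝔼 4) X] [IsManifold (𝓡 4) ∞ X] [SimplyConnectedSpace X]
      (o : SmoothOrientation (𝓡 4) X) (f : X → 𝕊²),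
      IsSimplifiedBrokenLefschetzFibration o f ∅ 0 →
      f '' ({p : X | ¬ Surjective (mfderiv (𝓡 4) (𝓡 2) f p)} \ (↑(∅ : Finset X) : Set X)) =
        sphereEquator 1 →
      ∀ (v : 𝕊²) (ιX : 𝕊² × 𝔼 2 → X), (v : 𝔼 3) 0 = 0 → (v : 𝔼 3) 1 = 0 →
      Manifold.IsSmoothEmbedding ((𝓡 2).prod (𝓡 2)) (𝓡 4) ∞ ιX →
      range ιX = f ⁻¹' {y : 𝕊² | ⟪(y : 𝔼 3), (v : 𝔼 3)⟫ < 0} →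
      (∀ p, f (ιX p) = (stereographic' 2 v).symm
        (OpenPartialHomeomorph.univBall (0 : 𝔼 2) 2 p.2)) →
      (∀ y : 𝕊², ⟪(y : 𝔼 3), ((-v : 𝕊²) : 𝔼 3)⟫ < 0 →
        (∀ q, f q = y → Surjective (mfderiv (𝓡 4) (𝓡 2) f q)) ∧
        Module.finrank ℤ (singularHomology ℤ ℤ ↥(f ⁻¹' {y}) 1) = 2) →
      ∀ hg : IsRegularLevel (𝓡 4) (SphereHeight.height (v : 𝔼 3) ∘ f) (-1 / 2),
      ∃ Φ : RegularSuperlevel hg ≃ₘ⟮𝓡∂ 4, 𝓡∂ 4⟯ SphereFourSplitting.PolarTube,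
        ∀ (k : (𝓡∂ 4).boundary (RegularSuperlevel hg)) (p : 𝕊² × 𝔼 2),
          RegularSublevel.incl hg.const_sub k.1 = ιX p →
          SphereFourSplitting.ι (SphereFourSplitting.ιV (Φ k.1)) 3 = p.2 0 ∧
          SphereFourSplitting.ι (SphereFourSplitting.ιV (Φ k.1)) 4 = p.2 1 := by
  intro _ hEE X _ _ _ _ _ _ _ o f hf hC v ιX hv0 hv1 hemb hrange hιf hhi hg
  obtain ⟨F, a', a, b, ha, e, α, h01, hab, he, h1, h2, h3, h4, h5, h6, h8, h7, heq, hlev, hbd⟩ :=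
    hFb hEE X o f hf hC v ιX hv0 hv1 hemb hrange hιf hhi
  obtain ⟨Φ, hΦ1, hΦ2⟩ := hR X ⟨o⟩ F a' a b ha e α h01 hab he h1 h2 h3 h4 h5 h6 h8 h7
  let Ψ := RegularSublevel.diffeomorphOfPreimageEq hg.const_sub ha.const_sub heq
  refine ⟨Ψ.trans Φ, fun k p hk => ?_⟩
  have hΨ : RegularSublevel.incl ha.const_sub (Ψ k.1) = RegularSublevel.incl hg.const_sub k.1 := rfl
  -- the boundary point lies on the level `⟪v, f⟫ = -1/2`, hence `F = a` there
  have hkb : (SphereHeight.height (v : 𝔼 3) ∘ f) (RegularSublevel.incl hg.const_sub k.1) = -1 / 2 := by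
    have hb : (-1 / 2 : ℝ) - (SphereHeight.height (v : 𝔼 3) ∘ f)
        (RegularSublevel.incl hg.const_sub k.1) = 0 :=
      (RegularSublevel.mem_boundary_iff hg.const_sub k.1).1 k.2
    linarith
  have hFa : F (RegularSublevel.incl ha.const_sub (Ψ k.1)) = a := by
    rw [hΨ]; exact hlev _ hkb
  -- not on the critical circle (there `F = b > a`)
  have hne : RegularSublevel.incl ha.const_sub (Ψ k.1) ∉ range e := by
    rintro ⟨u, hu⟩
    have := h3 u
    rw [hu, hFa] at this
    linarith
  obtain ⟨r, hr, hx3, hx4⟩ := hΦ2 (Ψ k.1) hne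
  have htube := hΦ1 (Ψ k.1) hFa
  rw [hΨ, hk] at hx3 hx4
  obtain ⟨hα, hnorm⟩ := hbd p (hk ▸ hkb)
  rw [hα] at hx3 hx4
  have hs0 : ((√2 : ℝ) • p.2) 0 = √2 * p.2 0 := by simp
  have hs1 : ((√2 : ℝ) • p.2) 1 = √2 * p.2 1 := by simp
  rw [hs0] at hx3
  rw [hs1] at hx4
  -- `tubeS = x₃² + x₄² = 1/2` and `x₃₄ = r √2 w`, `|w|² = 1/2` ⇒ `r √2 = 1`
  have htr : (Ψ.trans Φ) k.1 = Φ (Ψ k.1) := rfl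
  have hsum : SphereFourSplitting.ι (SphereFourSplitting.ιV (Φ (Ψ k.1))) 3 ^ 2 +
      SphereFourSplitting.ι (SphereFourSplitting.ιV (Φ (Ψ k.1))) 4 ^ 2 = 1 / 2 := by
    rw [← SphereFourSplitting.tubeS_eq_coord]; exact htube
  have hw : p.2 0 ^ 2 + p.2 1 ^ 2 = 1 / 2 := by
    rw [← hnorm, EuclideanSpace.norm_sq_eq]
    simp [Fin.sum_univ_two, sq_abs]
  have h22 : (√2 : ℝ) ^ 2 = 2 := Real.sq_sqrt zero_le_two
  have e1 : (r * (√2 * p.2 0)) ^ 2 + (r * (√2 * p.2 1)) ^ 2 =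
      r ^ 2 * (√2) ^ 2 * (p.2 0 ^ 2 + p.2 1 ^ 2) := by ring
  rw [hx3, hx4, e1, h22, hw] at hsum
  have hr2 : (r * √2) * (r * √2) = 1 := by
    have : (r * √2) * (r * √2) = r ^ 2 * (√2) ^ 2 := by ring
    rw [this, h22]; linarith
  have hpos : 0 < r * √2 := mul_pos hr (Real.sqrt_pos.2 zero_lt_two)
  have hrs : r * √2 = 1 := by
    rcases mul_self_eq_one_iff.mp hr2 with h | h
    · exact h
    · linarith
  rw [htr, hx3, hx4, ← mul_assoc, ← mul_assoc, hrs, one_mul, one_mul]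
  exact ⟨rfl, rfl⟩

end Summit.SmoothPoincare4.SmoothPoincare4.Cruxes.RungOne.Sketch
end
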